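import Summits.Langlands.Langlands.Theses.AbelianSurfaceSerre
import Literature.NumberTheory.PAdicHodge.FontaineDpst
import Literature.NumberTheory.GaloisRepresentations.LabelledHodgeTateWeights
import Literature.NumberTheory.GaloisRepresentations.CrystallineOrdinary
import Literature.FieldTheory.AlgClosed.PadicAlgClEquivComplex
import Literature.NumberTheory.Automorphic.PotentialAutomorphyCompatibleSystemGL4Rational
import Literature.NumberTheory.Automorphic.LocalGlobalAtPUnramified
import Literature.NumberTheory.Automorphic.PDAutomorphyLiftingGL4Rational
import Literature.NumberTheory.GaloisRepresentations.CompatibleSystemResidualIrreducibility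
import Literature.NumberTheory.GaloisRepresentations.CompatibleSystemSymplecticMembers
import Literature.NumberTheory.GaloisRepresentations.FKP2021GeometricLiftGSp4Rational
import Literature.NumberTheory.GaloisRepresentations.OrdinaryCrystallineSymplecticLiftNonGeneric
import Summits.Langlands.Langlands.Theorems.AbelianSurfaceSerreSerreGSp4SurjectiveSingerDefs
import Summits.Langlands.Langlands.Theorems.AbelianSurfaceSerreSerreGSp4SurjectiveSingerFamilyDefs
import Summits.Langlands.Langlands.Theorems.AbelianSurfaceSerreSerreGSp4SurjectiveStubAutomorphyLifting
import Summits.Langlands.Langlands.Theorems.AbelianSurfaceSerreSerreGSp4SurjectiveStubIrredOfResidual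
import Summits.Langlands.Langlands.Theorems.AbelianSurfaceSerreSerreGSp4SurjectiveStubIrredOnCycKernel
import Summits.Langlands.Langlands.Theorems.AbelianSurfaceSerreSerreGSp4SurjectiveStubCompanions
import Summits.Langlands.Langlands.Theorems.AbelianSurfaceSerreSerreGSp4SurjectiveStubCompanionsSymp
import Summits.Langlands.Langlands.Theorems.AbelianSurfaceSerreSerreGSp4SurjectiveStubResidualExists
import Summits.Langlands.Langlands.Theorems.AbelianSurfaceSerreSerreGSp4SurjectiveStubOrdinaryEndgame
import Summits.Langlands.Langlands.Theorems.AbelianSurfaceSerreSerreGSp4SurjectiveStubLiftExists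
import Summits.Langlands.Langlands.Theorems.AbelianSurfaceSerreSerreGSp4SurjectiveStubLiftExistsLanding

/-!
# Line `singer-type-evaporation` for the crux `SerreGSp4Surjective` (stmt-Langlands-17765) — skeleton v8 (lead c1)

Crux (FIXED, by name): `Summit.Langlands.Langlands.Theses.AbelianSurfaceSerre.SerreGSp4Surjective` —
Serre's conjecture for `GSp₄/ℚ` in regular ORDINARY weight, level prime to `p`, for all `p ≥ p₀`
and all `ρ̄ : Γ_ℚ → GL₄(𝔽_p)` with image ALL of `GSp(J)(𝔽_p)`, multiplier `ε̄⁻¹`, `ρ̄|Γ_{ℚ_p}`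
triangular with pairwise distinct diagonal.

## v8 (lead c1, 2026-08-17) — same line, same transfer idea (lift ONCE, move to ONE large prime `ℓ`,
## come back by compatibility), reshaped so that every stub but ONE is in print or pure glue

What changed relative to v6 (lead a1) and why.

* (C1, the anchor) v6's `stub_anchorPrime` asked for RESIDUAL automorphy of a companion and then
  ran BLGGT Thm 4.2.1 (`stub_automorphyLifting`, landed p157628) — which needs the `ℓ`-adic companion
  to be SYMPLECTIC with multiplier `ε_ℓ⁻¹` (`companion_symplectic`).  The landed compatible-system
  fact `BLGGT2014_thm551_compatibleSystem_rat_GL4` (p159229) asserts NO self-duality of the other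
  members (print asserts none), essential self-duality is Chebotarev + Brauer–Nesbitt but the SIGN of
  the pairing (symplectic vs orthogonal) of an irreducible companion is the Bellaïche–Chenevier /
  Taylor sign theorem for the potentially automorphic restriction — not reachable from the landed
  facts (lead a1's own CAUTION).  v8 therefore states the open input in AUTOMORPHY form and WITHOUT
  self-duality: `FLFontaineMazur` = Fontaine–Mazur–Langlands reciprocity for `Γ_ℚ → GL₄(ℚ̄_ℓ)`
  unramified a.e., crystalline at `ℓ` with four distinct labelled Hodge–Tate weights in the
  Fontaine–Laffaille range, irreducible, residually irreducible on `Γ_{ℚ(ζ_ℓ)}`, for all `ℓ ≥ ℓ₀`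
  (`stub_flFontaineMazur`; a standalone, line-independent statement in landed vocabulary only —
  the planner can file it as the conjecture it is).  BLGGT 4.2.1 and `companion_symplectic` leave the
  composition; the landed stubs 2, 4, 5 stay valid theorems (supports) but are no longer on the path.
* (C2, the lift) v6 recorded a POTENTIALLY ordinary / potentially crystalline `p`-adic lift of small
  parallel weight (nebentypus at `p`), which forced the endgame through Hida theory for `GSp₄`
  (control theorems, Gee–Geraghty §7; `GSp₄` automorphic vocabulary absent from the tree; partly not
  in print for `ε̄`-adjacent residues).  v8 records a CRYSTALLINE lift, Greenberg-ordinary on all of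
  `Γ_{ℚ_p}` with strictly increasing INTEGER cyclotomic exponents `b` (`b 0 + b 3 = 1` is what the
  pinned multiplier `ε⁻¹` forces, `Disproof.lean` §3b; negative exponents allowed, the endgame twists
  by `ε^{-k}`, `p - 1 ∣ k`, to land in the crux's `ℕ`-shape), so the endgame is local–global
  compatibility at `ℓ = p` (Caraiani 2014: `r_{π,ι}` crystalline at `p` ⇒ `π_p` unramified) plus
  cyclotomic-twist glue — no Hida theory.  The companions are then Fontaine–Laffaille at every
  `ℓ > (spread of b) + 2`, which the anchor prime may be chosen to exceed.
* (C3) `stub_singerFamily` is split into the `p`-adic lift (`stub_liftExists`: Fakhruddin–Khare–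
  Patrikis / BLGGT §3.2–4.3-type existence of crystalline-ordinary symplectic lifts with prescribed
  reduction and multiplier + a local ordinary-lift lemma; XL, in print) and the companions
  (`stub_companions`: glue over the LANDED facts BLGGT 5.5.1 (p159229) and 5.3.2 (p158720) plus
  Patrikis–Taylor irreducibility), with the group theory "`GSp₄(𝔽_p)` image ⇒ irreducible on
  `Γ_{ℚ(ζ_p)}`" isolated as the pure stub `stub_irredOnCycKernel`.

## v9 (lead c1, after wave 1 and the strategist's r1 census) — the open input back in RESIDUAL SYMPLECTIC form

Wave 1 landed `stub_irredOnCycKernel` (p164826), `stub_companions` (p169675, with the vendored Patrikis–Taylor fact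
p169196), `stub_familyTransfer` (p164075 with the vocabulary), the `ℓ = p` fact (p167928) and the endgame modulo it
(p169763).  The r1 census (STRATEGY-CENSUS-r1.md §0) observed that v8's `FLFontaineMazur` (automorphy form, no
self-duality) is STRONGER than what any architecture consumes; v9 therefore (i) restores the residual symplectic form
`K*` as `FLSerreSymplectic` — along a shared residue map and for all `ℓ ≥ ℓ₀` (the two corrections r1's `KStarAt/KStar`
need to feed the landed lifting stub) —, (ii) restores the landed BLGGT 4.2.1 stub `stub_automorphyLifting` (p157628)
in the composition, (iii) adds the provable glue `stub_residualExists` (a finite-field residual representation of an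
`ℓ`-adic representation exists along some residue map) and (iv) asks the companions to be SYMPLECTIC
(`stub_companionsSymp`: the sign of the pairing of the members, Bellaïche–Chenevier for the potentially automorphic
restriction + Patrikis–Taylor irreducibility over `F'`, ONE more composite named fact to vendor, same standing as the
accepted p169196).

## v9.2 (wave 2 integrated, `stub_liftExists` landed p171823) — TERMINAL SHAPE: two `sorry`s, neither closable by a prover

Wave 2 landed `stub_residualExists` (p171758), `stub_companionsSymp` (p171794, + composite sign fact p171714),
`stub_ordinaryEndgame` (p169763), and `stub_liftExists` modulo two vendored facts (helper p171557, wrapper p171823).  What remains: `stub_namedFacts` — the conjunction of SEVEN named facts (literature debts, six theorem-grade in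
print, one (local symplectic ordinary lift in the `ε̄`-adjacent case) printed only as a sketch) — and `stub_flSerre` —
the open kernel `K*`.  I.e. the crux is CLOSED MODULO {facts in print} ∪ {K*}; nothing else in the line can move.

Composition `SerreGSp4Surjective_of`: pure logic over the seven stubs (checked, no `sorry` outside
`stub_*`).  Disproof.lean honoured: §3 parity — the lift's multiplier is pinned to `ε⁻¹` (`cycInv`);
§3 triangularity (H2) consumed by `stub_liftExists`; §3b weight class — integer exponents with
`b 0 + b 3 = 1`, never the crystalline Calabi–Yau `ℕ`-shape; §4 (p147593) — no void in the line.
-/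

set_option linter.dupNamespace false

namespace Summit.Langlands.Langlands.Cruxes.SerreGSp4Surjective.SingerTypeEvaporation

open Literature.NumberTheory.GaloisRepresentations Literature.NumberTheory.Automorphic
  Literature.NumberTheory.PAdicHodge
open scoped NumberField
open IsDedekindDomain Polynomial Filter

noncomputable section

/-! ## Vocabulary (v8 additions; the rest is imported from the landed Theorems files) -/

section VocabularyV9

/-- **`K*` — Serre for `GSp₄/ℚ` in Fontaine–Laffaille weight, residual and symplectic form, ALONG a residue map**
(THE OPEN INPUT of the line, stated standalone in landed vocabulary; the crux-strategist r1's typed kernel `KStarAt`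
with (i) the residue map SHARED between hypothesis and conclusion — `ReducesAlong` / `ResiduallyAutomorphicAlong`, the
form the landed lifting stub consumes, lead a1's repair M1 — and (ii) `∀ ℓ ≥ ℓ₀` instead of "an unbounded set of `ℓ`",
because the family's `good` set is only unbounded, not cofinite): there is `ℓ₀` such that for every prime `ℓ ≥ ℓ₀`,
every multiset `wts` of four distinct integers inside an interval `[lo, hi]` with `hi - lo + 2 ≤ ℓ`, every continuous
`r' : Γ_ℚ → GL₄(ℚ̄_ℓ)` SYMPLECTIC with multiplier `ε_ℓ⁻¹`, unramified at almost all places and crystalline at `ℓ` with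
labelled Hodge–Tate weights `wts`, and every finite-field residual representation `ρ'` of `r'` along a residue map `red`
which is irreducible on `Γ_{ℚ(ζ_ℓ)}`, `ρ'` is RESIDUALLY AUTOMORPHIC along `red`: some regular algebraic cuspidal `π` on
`GL₄(𝔸_ℚ)` unramified at `ℓ` has an `ℓ`-adic `r₁`, symplectic-`ε_ℓ⁻¹` and Fontaine–Laffaille crystalline, reducing to
`ρ'` along the same `red`.  A CONJECTURE (the weight-`wts` case of Serre-type conjectures for `GSp₄`, Herzig–Tilouine;
implied by Fontaine–Mazur–Langlands for `r'`); no case in print.  Weaker than v8's `FLFontaineMazur` (automorphy form,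
no self-duality) by exactly the landed BLGGT Thm 4.2.1 (`stub_automorphyLifting`, p157628), which v9 restores.
[cite: HerzigTilouine2013, Conj. 1] [cite: FontaineMazurGeometric1995, Conj. 1] -/
def FLSerreSymplectic : Prop :=
  ∃ ℓ₀ : ℕ, ∀ (ℓ : ℕ) [Fact ℓ.Prime], ℓ₀ ≤ ℓ →
    ∀ (wts : Multiset ℤ) (lo hi : ℤ), wts.Nodup → Multiset.card wts = 4 →
      (∀ x ∈ wts, lo ≤ x ∧ x ≤ hi) → hi - lo + 2 ≤ (ℓ : ℤ) →
    ∀ r' : FramedGaloisRep ℚ (PadicAlgCl ℓ) 4,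
      r'.IsSymplecticWithMultiplierFun (cycInv ℓ) →
      (∀ᶠ v : HeightOneSpectrum (𝓞 ℚ) in Filter.cofinite, r'.IsUnramifiedAt v) →
      IsCrystallineWithWeightsAt ℓ wts r' →
    ∀ (k : Type) [Field k] [Fintype k] [CharP k ℓ] [TopologicalSpace k] [DiscreteTopology k]
      (ρ' : FramedGaloisRep ℚ k 4)
      (red : (Valued.v : Valuation (PadicAlgCl ℓ) NNReal).valuationSubring →+* AlgebraicClosure k),
      ReducesAlong ℓ red r' ρ' → IrredOnCycKernel ℓ ρ' → ResiduallyAutomorphicAlong ℓ red ρ'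

end VocabularyV9

/-! ## The package (LANDED vocabulary)

`PotentiallyCrystallineAt`, `OrdinaryLift`, `SingerFamily` (two layers: the `p`-adic crystalline-ordinary lift, then the
companions) and the proved stub 6/7 `stub_familyTransfer` are imported from the landed
`Theorems/AbelianSurfaceSerreSerreGSp4SurjectiveSingerFamilyDefs.lean` (p164075). -/

/-! ## Stubs (registered; `sorry` lives ONLY here) -/

/-! stub 1/7 `stub_irredOnCycKernel` — LANDED (p164826,
`Theorems/AbelianSurfaceSerreSerreGSp4SurjectiveStubIrredOnCycKernel.lean`, imported): `3 ≤ p → FullSymplecticImage p ρ →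
IrredOnCycKernel p ρ` (symplectic transvections). -/

/-! stub 2/7 `stub_liftExists` — LANDED (p171823 wrapper over p171557 `stub_liftExists_of`,
`Theorems/AbelianSurfaceSerreSerreGSp4SurjectiveStubLiftExists{,Landing}.lean`, imported):
`Yamauchi2020_sec941_ordinarySymplecticLift_rat → FKP2021_thmA_ordinaryCrystallineLift_GSp4_rat → ∃ p₁, …`.  CAVEAT (the one
link of the line not rigorously in print): for `ε̄`-ADJACENT residual diagonal characters (très-ramifiée type) the LOCAL
symplectic ordinary lift `Yamauchi2020_sec941_…` (p171175) is printed only as a sketch in an unrefereed preprint; the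
generic case is the rigorous Gee–Geraghty 2012 Lemma 7.6.7-type fact (p170640) and p171557 also proves
`stub_liftExists_generic_of` under the extra hypothesis `OrdinaryGenericAt p ρ̄` ((H2) + `χ̄_i ≠ ε̄ χ̄_j`).  The GLOBAL link is
FKP 2021 Thm A for `GSp₄/ℚ` with the crystalline-ordinary component at `p` (p171174).  No twist was needed: local exponents
with `e₀+e₃ = e₁+e₂ = -1`, multiplier `ε⁻¹` throughout. -/

/-! v8 stub `stub_companions` — LANDED (p169675, `Theorems/AbelianSurfaceSerreSerreGSp4SurjectiveStubCompanions.lean`,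
imported) in the corrected form `BLGGT2014_thm551_compatibleSystem_rat_GL4 → BLGGT2014_prop532_residuallyIrreducible_densityOne →
PatrikisTaylor2015_thm17_irreducibleMembers_rat_GL4 → ∃ p₂, …` (wave 1 finding: the members' irreducibility is served by neither
BLGGT fact; Patrikis–Taylor 2015 Thm 1.7 vendored as the named fact p169196).  v9 asks more of the companions (symplectic),
see `stub_companionsSymp`; the landed construction is the model to extend. -/

/-- stub 3/7 — **THE NAMED FACTS THEMSELVES** (literature debts, not tasks of this line): BLGGT 2014
Thm 5.5.1 and Prop 5.3.2 over `ℚ` for `GL₄`, as vendored in the accepted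
`Literature.NumberTheory.Automorphic.BLGGT2014_thm551_compatibleSystem_rat_GL4` (p159229) and
`Literature.NumberTheory.GaloisRepresentations.BLGGT2014_prop532_residuallyIrreducible_densityOne`
(p158720); Caraiani 2014 Thm 1.1, `ℓ = p` local–global compatibility in the form "crystalline ⇒ `π_p` unramified"
(`Literature.NumberTheory.Automorphic.Caraiani2014_crystalline_unramified_rat_GL4`, p167928, vendored by wave 1);
BLGGT 2014 Thm 4.2.1 over `ℚ`, `n = 4`, Fontaine–Laffaille case (`Literature.NumberTheory.Automorphic.BLGGT2014_thm421_rat_GL4`,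
p155510, restored in v9 with the residual form of the open input).  Registered as a stub only because a skeleton's
hypotheses must be declared obligations; every result through it is CONDITIONAL on the named facts (D-0014).  v9.1
adds the wave-2 facts: the composite sign-and-irreducibility fact for the companions
(`BellaicheChenevier2011_cor13_irreducibleSymplecticMembers_rat_GL4`, p171714), the LOCAL symplectic ordinary lift
(`Yamauchi2020_sec941_ordinarySymplecticLift_rat`, p171175 — the one link NOT rigorously in print for `ε̄`-adjacent
residual characters, see `stub_liftExists`) and the GLOBAL lift (`FKP2021_thmA_ordinaryCrystallineLift_GSp4_rat`,
p171174).  All seven are theorem-grade statements of the cited sources except the flagged sub-case of the sixth.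
[cite: BarnetlambEtAl2014, Thm 5.5.1, Prop 5.3.2 and Thm 4.2.1] [cite: Caraiani2014, Thm. 1.1]
[cite: BellaicheChenevier2011, Cor. 1.3] [cite: FakhruddinKharePatrikis2021, Thm. A] -/
theorem stub_namedFacts :
    BLGGT2014_thm551_compatibleSystem_rat_GL4 ∧ BLGGT2014_prop532_residuallyIrreducible_densityOne ∧
      Caraiani2014_crystalline_unramified_rat_GL4 ∧ BLGGT2014_thm421_rat_GL4 ∧
      BellaicheChenevier2011_cor13_irreducibleSymplecticMembers_rat_GL4 ∧
      Yamauchi2020_sec941_ordinarySymplecticLift_rat ∧ FKP2021_thmA_ordinaryCrystallineLift_GSp4_rat := by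
  sorry

/-! stub 4/7 `stub_residualExists` — LANDED (p171758, `Theorems/AbelianSurfaceSerreSerreGSp4SurjectiveStubResidualExists.lean`,
imported): every `r : Γ_ℚ → GL₄(ℚ̄_ℓ)` reduces along some residue map to a continuous representation over a FINITE field
(integral model over `𝒪_{ℚ̄_ℓ}`, open kernel of the reduction, the finite subfield generated by the image, `IsAlgClosed.lift`). -/

/-! stub 4b/7 `stub_companionsSymp` — LANDED (p171794, `Theorems/AbelianSurfaceSerreSerreGSp4SurjectiveStubCompanionsSymp.lean`,
imported) in the corrected form with the vendored composite sign-and-irreducibility fact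
`BellaicheChenevier2011_cor13_irreducibleSymplecticMembers_rat_GL4` (p171714: BLGGT Cor 4.5.2 + Patrikis–Taylor Thm 1.7
over `F'` + Bellaïche–Chenevier Cor 1.3 + Chebotarev/Brauer–Nesbitt/Schur; POSITIVE density, both conjuncts on one set) as
third antecedent. -/

/-- stub 4c/7 — **THE OPEN INPUT `K*`**: Serre for `GSp₄/ℚ` in Fontaine–Laffaille weight, residual symplectic form
along a residue map, for all large `ℓ` (`FLSerreSymplectic`).  This is where the line TRANSFERS the crux: Serre for
`GSp₄/ℚ` at `p` in every ordinary weight follows from residual automorphy of ONE finite-field reduction of ONE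
`ℓ`-adic companion at ONE prime `ℓ` chosen in a set unbounded above, plus the landed BLGGT 4.2.1.  Open;
conjecture-grade (lead a1's verdict on the anchor; strategists s2, r1: "the weakest statement any known architecture
consumes"). [cite: HerzigTilouine2013, Conj. 1] -/
theorem stub_flSerre : FLSerreSymplectic := by
  sorry

/-! stub 5/7 `stub_ordinaryEndgame` — LANDED (p169763, `Theorems/AbelianSurfaceSerreSerreGSp4SurjectiveStubOrdinaryEndgame.lean`,
imported): `Caraiani2014_crystalline_unramified_rat_GL4 → ∃ p₅, …` — automorphic crystalline-ordinary lift ⇒ the crux's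
conclusion (`π` unramified at `p` by Caraiani's `ℓ = p` compatibility, p167928; twist by `ε^{-k}`, `p - 1 ∣ k`, to the
`ℕ`-shape; glue p166443). -/

/-! stub 6/7 `stub_familyTransfer` — LANDED (p164075, in the vocabulary file, imported). -/

/-! ## Composition (kernel-checked, no `sorry` outside `stub_*`) -/

/-- The inner step for one `p` and one `ρ̄` (v9): family with symplectic companions ⇒ a good prime `ℓ` beyond `ℓ₀`,
`11` and the Fontaine–Laffaille spread ⇒ a finite-field residual representation of the companion along some `red`
(`stub_residualExists`) ⇒ it is irreducible on `Γ_{ℚ(ζ_ℓ)}` (`companion_rigid`) ⇒ residually automorphic along `red`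
(THE OPEN INPUT `K*`) ⇒ the companion is automorphic (landed `stub_automorphyLifting` = BLGGT 4.2.1, p157628) ⇒ the
lift is automorphic (landed `stub_familyTransfer`) ⇒ endgame. [folklore] -/
theorem regularOrdinaryModular_of_family {p : ℕ} [Fact p.Prime]
    {ρ : FramedGaloisRep ℚ (ZMod p) 4} (𝓕 : SingerFamily p ρ)
    (hsymp : ∀ (ℓ : ℕ) [Fact ℓ.Prime] (h : ℓ ∈ 𝓕.good),
      (𝓕.companion ℓ h).IsSymplecticWithMultiplierFun (cycInv ℓ))
    (h421 : BLGGT2014_thm421_rat_GL4) (hK : FLSerreSymplectic)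
    (hres : ∀ (ℓ : ℕ) [Fact ℓ.Prime] (r : FramedGaloisRep ℚ (PadicAlgCl ℓ) 4),
      ∃ (k : Type) (_ : Field k) (_ : Fintype k) (_ : CharP k ℓ) (_ : TopologicalSpace k)
        (_ : DiscreteTopology k) (ρ' : FramedGaloisRep ℚ k 4)
        (red : (Valued.v : Valuation (PadicAlgCl ℓ) NNReal).valuationSubring →+* AlgebraicClosure k),
        ReducesAlong ℓ red r ρ')
    (hend : AutomorphicAE p 𝓕.lift → RegularOrdinaryModular p ρ) :
    RegularOrdinaryModular p ρ := by
  obtain ⟨ℓ₀, hK⟩ := hK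
  obtain ⟨ℓ, hℓprime, hℓ, hNℓ⟩ := 𝓕.good_unbounded (ℓ₀ + 11 + (𝓕.hi - 𝓕.lo + 2).toNat)
  haveI : Fact ℓ.Prime := ⟨hℓprime⟩
  have hℓ₀ : ℓ₀ ≤ ℓ := le_trans (le_trans (Nat.le_add_right _ _) (Nat.le_add_right _ _)) hNℓ
  have h11 : 11 ≤ ℓ := le_trans (le_trans (Nat.le_add_left _ _) (Nat.le_add_right _ _)) hNℓ
  have hFL : 𝓕.hi - 𝓕.lo + 2 ≤ (ℓ : ℤ) := by
    have h1 : ((𝓕.hi - 𝓕.lo + 2).toNat : ℤ) ≤ (ℓ : ℤ) := by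
      exact_mod_cast le_trans (Nat.le_add_left _ _) hNℓ
    exact le_trans (Int.self_le_toNat _) h1
  have hunr := 𝓕.companion_unramified hℓ
  obtain ⟨k, _, _, _, _, _, ρ', red, hred⟩ := hres ℓ (𝓕.companion ℓ hℓ)
  have hirrN : IrredOnCycKernel ℓ ρ' := 𝓕.companion_rigid ℓ hℓ k ρ' red hred
  have hra : ResiduallyAutomorphicAlong ℓ red ρ' :=
    hK ℓ hℓ₀ 𝓕.wts 𝓕.lo 𝓕.hi 𝓕.wts_nodup 𝓕.wts_card 𝓕.wts_range hFL (𝓕.companion ℓ hℓ) (hsymp ℓ hℓ)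
      hunr (𝓕.companion_crystalline ℓ hℓ) k ρ' red hred hirrN
  have haut : AutomorphicAE ℓ (𝓕.companion ℓ hℓ) :=
    stub_automorphyLifting h421 ℓ h11 𝓕.wts 𝓕.lo 𝓕.hi (𝓕.companion ℓ hℓ) k ρ' red 𝓕.wts_nodup
      𝓕.wts_card 𝓕.wts_range hFL (𝓕.companion_irreducible ℓ hℓ) (hsymp ℓ hℓ)
      (𝓕.companion_crystalline ℓ hℓ) hunr hred hirrN hra
  exact hend (stub_familyTransfer p ρ 𝓕 ℓ hℓ haut)

/-- **The line closes the crux modulo its stubs**: `SerreGSp4Surjective` from the registered stubs (the named facts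
through `stub_namedFacts`; the landed stubs imported).  Conclusion is the crux BY NAME;
`p₀ = max 3 (max p₁ (max p₂ p₅))`. [folklore] -/
theorem SerreGSp4Surjective_of :
    Summit.Langlands.Langlands.Theses.AbelianSurfaceSerre.SerreGSp4Surjective := by
  obtain ⟨h551, h532, hLG, h421, hBC, hYam, hFKP⟩ := stub_namedFacts
  obtain ⟨p₁, h₁⟩ := stub_liftExists hYam hFKP
  obtain ⟨p₂, h₂⟩ := stub_companionsSymp h551 h532 hBC
  obtain ⟨p₅, h₅⟩ := stub_ordinaryEndgame hLG
  refine serreGSp4Surjective_iff.mpr ⟨max 3 (max p₁ (max p₂ p₅)), fun p _ hp ρ hH1 hH2 => ?_⟩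
  have hp₃ : 3 ≤ p := (le_max_left _ _).trans hp
  have hp' : max p₁ (max p₂ p₅) ≤ p := (le_max_right _ _).trans hp
  have hp₁ : p₁ ≤ p := (le_max_left _ _).trans hp'
  have hp₂ : p₂ ≤ p := ((le_max_left _ _).trans (le_max_right _ _)).trans hp'
  have hp₅ : p₅ ≤ p := ((le_max_right _ _).trans (le_max_right _ _)).trans hp'
  have hirr : IrredOnCycKernel p ρ := stub_irredOnCycKernel p ρ hp₃ hH1
  obtain ⟨𝓕, hsymp⟩ := h₂ p hp₂ ρ hirr (h₁ p hp₁ ρ hH1 hH2)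
  exact regularOrdinaryModular_of_family 𝓕 hsymp h421 stub_flSerre stub_residualExists
    (h₅ p hp₅ ρ hirr 𝓕.toOrdinaryLift)

end

end Summit.Langlands.Langlands.Cruxes.SerreGSp4Surjective.SingerTypeEvaporation
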